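import Literature.NumberTheory.EllipticCurves.IsogenyDualKernelCyclotomic
import Literature.NumberTheory.EllipticCurves.IsogenyDescentWeilFunction
import Literature.NumberTheory.GaloisRepresentations.GaloisCohomologyKummerProofs
import HarnessLib

/-!
# The `μ_p`-character of the dual kernel and the Kummer invariant of a `ψ`-cohomology class
# (Silverman, *AEC*, X.4.9 / Exercise 10.1: `H¹(K, E'[φ̂]) = H¹(K, μ_p) = Kˣ/Kˣᵖ`)

PROOF-AND-CONSTRUCTION file, topic `NumberTheory/EllipticCurves`. Let `E/F` be an elliptic curve,
`p ≠ char F` prime, `T ∈ E(F̄)` a `Γ_F`-fixed point of order `p`, `φ : E → E'` an isogeny with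
`ker φ = ⟨T⟩` and `ψ : E' → E` with `ψ ∘ φ = [p]` (the dual). The companion file
`IsogenyDualKernelCyclotomic` shows `ker ψ = φ(E[p])` is `μ_p`-isotypic. Here the identification
`ker ψ ≅ μ_p` is made EXPLICIT and pushed to cohomology:

* §1 **`dualKerChar`** `: ker ψ →+ μ_p(F̄)` (additively, values in the tree's `MuCarrier F p`),
  `Q = φ(S) ↦ e_p(S, T)` — the Weil pairing with `T` of any `φ`-preimage (tree `weilPairingFun`;
  independent of `S` because `ker φ = ⟨T⟩` pairs trivially with `T`). It is additive
  (`weilPairingFun_add_left`), INJECTIVE (`dualKerChar_eq_zero_iff`: the kernel of `e_p(·, T)` on `E[p]`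
  is `⟨T⟩ = ker φ`), onto `μ_p` (`dualKerChar_surjective`), and `Γ_F`-EQUIVARIANT
  (`dualKerChar_smul`: `e_p(σS, σT) = σ e_p(S, T)` and `σT = T`). This is the isomorphism
  `E'[φ̂] ≅ μ_p` of Silverman X.4.9 (`p = 2`) / Exercise 10.1 / Fisher 2001 §1.
* §2 **`dualKerCharH1 : H¹(F, ker ψ) →+ H¹(F, μ_p)`** (Mathlib `ContinuousCohomology.map` along the
  `TopRep` morphism `dualKerCharHom`), its value on explicit cocycles, and its INJECTIVITY
  (`dualKerCharH1_injective`: a class whose image is a coboundary `σv − v`, `v = χ(Q₁)`, is the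
  coboundary of `Q₁`).
* §3 **`kummerInvariant := kummerEquiv ∘ dualKerCharH1 : H¹(F, ker ψ) →+ Fˣ/Fˣᵖ`** (Kummer theory,
  tree `kummerEquiv`), injective; and its COMPUTATION RULE `kummerInvariant_eq_of_root`: if
  `χ(c(σ)) = σ(α)/α` for all `σ` with `αᵖ = a ∈ Fˣ`, then the invariant of `[c]` is `[a]`; by
  Hilbert 90 such `α, a` always exist (`exists_root_of_cocycle`). So the `ψ`-Selmer group
  `Sel^ψ(E'/F) ⊆ H¹(F, ker ψ)` EMBEDS in `Fˣ/Fˣᵖ` — the Kummer box of the `μ_p`-side of the descent.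

Definitions carry bodies (no named fact, no `sorry`); written for the `μ₅`-side of the `5`-descent on
the Kubert–Tate curve `E_{13/14}` (route ShaPrimaryTransfer, door at `5`), generic in `(E, p, T, φ, ψ)`.

## References

* [SilvermanAEC2009] J. H. Silverman, *The Arithmetic of Elliptic Curves*, 2nd ed., III.§8
  (Prop. III.8.1), Thm. X.4.2, Prop. X.4.9, Exercise 10.1.
* [Fisher2001FiveSevenDescent] T. Fisher, JEMS 3 (2001), §1 (`E[φ̂] ≅ μ_p`, `H¹(ℚ, μ_p) = ℚˣ/ℚˣᵖ`).
* [SerreGaloisCohomology1997] J.-P. Serre, *Galois Cohomology*, I.§2.4, II.§1.2 (Kummer theory).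

## Design

`noncomputable section`, `open scoped Classical`, universe `u` with `F : Type u` (as in
`IsogenySelmerGroups`, `TwoDescentTwoTorsionCharacter`); the `Γ_F`-action on `ker ψ` is
`Isogeny.kerAction` supplied by `letI`. The `TopRep`/`H¹` plumbing copies `twoTorsionCharHom` /
`twoTorsionCharH1` of `TwoDescentTwoTorsionCharacter.lean`.
-/

noncomputable section

open scoped Classical

universe u

namespace WeierstrassCurve.Isogeny

open Literature.NumberTheory.EllipticCurves Literature.NumberTheory.GaloisRepresentations
  Literature.NumberTheory.GaloisRepresentations.DiscreteGaloisModule Field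

variable {F : Type u} [Field F] {W W' : WeierstrassCurve F} [W.IsElliptic] [W'.IsElliptic]
  (φ : Isogeny W W') (ψ : Isogeny W' W) {p : ℕ} [Fact p.Prime] [NeZero (p : F)]
  (h : ∀ P, ψ (φ P) = (p : ℤ) • P)
  (T : W.geomPoints) (hT : (p : ℤ) • T = 0) (hT0 : T ≠ 0)
  (hTfix : ∀ σ : absoluteGaloisGroup F, σ • T = T)
  (hker : φ.toAddMonoidHom.ker = AddSubgroup.zmultiples T)

/-! ## §0 `ker φ = ⟨T⟩` from a point count -/

omit [W.IsElliptic] [W'.IsElliptic] [NeZero (p : F)] in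
/-- `ker φ = ⟨T⟩` as soon as `T ∈ ker φ` has order `p = #ker φ` (both sides have `p` elements).
[cite: SilvermanAEC2009, Thm. III.4.10(c)] -/
theorem ker_eq_zmultiples_of_natCard_eq (hcard : Nat.card φ.toAddMonoidHom.ker = p)
    (hTmem : T ∈ φ.toAddMonoidHom.ker) (hT : (p : ℤ) • T = 0) (hT0 : T ≠ 0) :
    φ.toAddMonoidHom.ker = AddSubgroup.zmultiples T := by
  have hp : p.Prime := Fact.out
  have hle : AddSubgroup.zmultiples T ≤ φ.toAddMonoidHom.ker := AddSubgroup.zmultiples_le.mpr hTmem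
  have hordT : addOrderOf T = p := by
    have h1 : addOrderOf T ∣ p := addOrderOf_dvd_of_nsmul_eq_zero (by rw [← natCast_zsmul]; exact hT)
    rcases (Nat.dvd_prime hp).mp h1 with h1 | h1
    · exact absurd (AddMonoid.addOrderOf_eq_one_iff.mp h1) hT0
    · exact h1
  haveI : Finite φ.toAddMonoidHom.ker := φ.finite_ker'
  symm
  apply AddSubgroup.eq_of_le_of_card_ge hle
  rw [hcard, Nat.card_zmultiples, hordT]

/-! ## §1 The character `χ : ker ψ → μ_p`, `φ(S) ↦ e_p(S, T)` -/

section Character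

include h hT hker

omit [W.IsElliptic] [W'.IsElliptic] [NeZero (p : F)] [Fact p.Prime] h hT in
/-- Two `φ`-preimages of the same point differ by an element of `ker φ = ⟨T⟩`. [cite: SilvermanAEC2009, Thm. III.4.10(c)] -/
theorem sub_mem_zmultiples_of_apply_eq {S S' : W.geomPoints} (he : φ S = φ S') :
    S - S' ∈ AddSubgroup.zmultiples T := by
  rw [← hker, AddMonoidHom.mem_ker, coe_toAddMonoidHom, map_sub, he, sub_self]

omit [W'.IsElliptic] h in
/-- **`e_p(S, T)` depends only on `φ(S)`** for `S ∈ E[p]` (preimages differ by multiples of `T`, which pair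
trivially with `T`). [cite: SilvermanAEC2009, Prop. III.8.1(a),(b)] -/
theorem weilPairingFun_eq_of_apply_eq {S S' : W.geomPoints} (hS : (p : ℤ) • S = 0)
    (hS' : (p : ℤ) • S' = 0) (he : φ S = φ S') :
    weilPairingFun (natCast_level_ne_zero F p) S T = weilPairingFun (natCast_level_ne_zero F p) S' T := by
  have hd : (p : ℤ) • (S - S') = 0 := by rw [smul_sub, hS, hS', sub_self]
  have h1 := weilPairingFun_eq_one_of_mem_zmultiples hT (sub_mem_zmultiples_of_apply_eq φ T hker he)
  have h2 : S = S' + (S - S') := by abel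
  conv_lhs => rw [h2]
  rw [weilPairingFun_add_left _ hS' hd hT, h1, mul_one]

/-- The value `e_p(S, T) ∈ F̄` attached to `Q ∈ ker ψ` through a chosen `φ`-preimage `S ∈ E[p]`
(`ker ψ = φ(E[p])`, tree `Isogeny.mem_ker_dual_iff`). [cite: SilvermanAEC2009, Exercise 10.1 / Prop. X.4.9] -/
def dualKerCharVal (Q : ψ.toAddMonoidHom.ker) : AlgebraicClosure F :=
  weilPairingFun (natCast_level_ne_zero F p) (Classical.choose ((mem_ker_dual_iff φ ψ h Q.1).mp Q.2)) T

/-- **Computation rule**: `χ(φ S) = e_p(S, T)` for ANY preimage `S ∈ E[p]`. [cite: SilvermanAEC2009, Exercise 10.1] -/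
theorem dualKerCharVal_eq (Q : ψ.toAddMonoidHom.ker) {S : W.geomPoints} (hS : (p : ℤ) • S = 0)
    (hSQ : φ S = Q) : dualKerCharVal φ ψ h T Q = weilPairingFun (natCast_level_ne_zero F p) S T := by
  obtain ⟨hS₀, hS₀Q⟩ := Classical.choose_spec ((mem_ker_dual_iff φ ψ h Q.1).mp Q.2)
  unfold dualKerCharVal
  exact weilPairingFun_eq_of_apply_eq φ T hT hker (AddSubgroup.torsionBy.nsmul_iff.mp hS₀ |> fun e ↦ by
    rw [← natCast_zsmul] at e; exact e) hS (hS₀Q.trans hSQ.symm)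

/-- `χ(Q)ᵖ = 1`: the values are `p`-th roots of unity. [cite: SilvermanAEC2009, III.§8] -/
theorem dualKerCharVal_pow (Q : ψ.toAddMonoidHom.ker) : dualKerCharVal φ ψ h T Q ^ p = 1 := by
  obtain ⟨S, hS, hSQ⟩ := (mem_ker_dual_iff φ ψ h Q.1).mp Q.2
  have hS' : (p : ℤ) • S = 0 := by rw [natCast_zsmul]; exact AddSubgroup.torsionBy.nsmul_iff.mp hS
  rw [dualKerCharVal_eq φ ψ h T hT hker Q hS' hSQ]
  exact weilPairingFun_pow _ hS' hT

/-- **The character `χ : ker ψ →+ μ_p(F̄)`** (additive notation, values in the carrier `MuCarrier F p`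
of the tree's Galois module `μ_p`): `φ(S) ↦ e_p(S, T)`. [cite: SilvermanAEC2009, Exercise 10.1 / Prop. X.4.9]
[cite: Fisher2001FiveSevenDescent, §1] -/
def dualKerChar : ψ.toAddMonoidHom.ker →+ MuCarrier F p where
  toFun Q := MuCarrier.ofRootsOfUnity (rootsOfUnity.mkOfPowEq _ (dualKerCharVal_pow φ ψ h T hT hker Q))
  map_zero' := by
    apply muVal_injective F p
    rw [muVal_ofRootsOfUnity, muVal_zero]
    ext
    rw [rootsOfUnity.val_mkOfPowEq_coe, Units.val_one,
      dualKerCharVal_eq φ ψ h T hT hker 0 (smul_zero _) (by rw [map_zero]; rfl)]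
    exact weilPairingFun_zero_left _ hT
  map_add' Q Q' := by
    apply muVal_injective F p
    rw [muVal_add, muVal_ofRootsOfUnity, muVal_ofRootsOfUnity, muVal_ofRootsOfUnity]
    ext
    rw [Units.val_mul, rootsOfUnity.val_mkOfPowEq_coe, rootsOfUnity.val_mkOfPowEq_coe,
      rootsOfUnity.val_mkOfPowEq_coe]
    obtain ⟨S, hS, hSQ⟩ := (mem_ker_dual_iff φ ψ h Q.1).mp Q.2
    obtain ⟨S', hS', hSQ'⟩ := (mem_ker_dual_iff φ ψ h Q'.1).mp Q'.2
    have hSz : (p : ℤ) • S = 0 := by rw [natCast_zsmul]; exact AddSubgroup.torsionBy.nsmul_iff.mp hS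
    have hSz' : (p : ℤ) • S' = 0 := by rw [natCast_zsmul]; exact AddSubgroup.torsionBy.nsmul_iff.mp hS'
    have hsum : (p : ℤ) • (S + S') = 0 := by rw [smul_add, hSz, hSz', add_zero]
    rw [dualKerCharVal_eq φ ψ h T hT hker Q hSz hSQ, dualKerCharVal_eq φ ψ h T hT hker Q' hSz' hSQ',
      dualKerCharVal_eq φ ψ h T hT hker (Q + Q') hsum (by rw [map_add, hSQ, hSQ']; rfl)]
    exact weilPairingFun_add_left _ hSz hSz' hT

/-- `χ` down to `F̄`: `muVal (χ Q) = χval Q`. [cite: SilvermanAEC2009, Exercise 10.1] -/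
theorem coe_muVal_dualKerChar (Q : ψ.toAddMonoidHom.ker) :
    ((muVal F p (dualKerChar φ ψ h T hT hker Q) : (AlgebraicClosure F)ˣ) : AlgebraicClosure F) =
      dualKerCharVal φ ψ h T Q :=
  rfl

/-- **`χ(φ S) = e_p(S, T)`** for every `S ∈ E[p]`, down to `F̄`. [cite: SilvermanAEC2009, Exercise 10.1] -/
theorem coe_muVal_dualKerChar_eq (Q : ψ.toAddMonoidHom.ker) {S : W.geomPoints} (hS : (p : ℤ) • S = 0)
    (hSQ : φ S = Q) :
    ((muVal F p (dualKerChar φ ψ h T hT hker Q) : (AlgebraicClosure F)ˣ) : AlgebraicClosure F) =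
      weilPairingFun (natCast_level_ne_zero F p) S T :=
  dualKerCharVal_eq φ ψ h T hT hker Q hS hSQ

include hT0 in
/-- **`χ` is injective**: `χ(Q) = 1 ⟹ Q = O` (`e_p(S, T) = 1` forces `S ∈ ⟨T⟩ = ker φ`, tree
`mem_zmultiples_of_weilPairingFun_eq_one`). [cite: SilvermanAEC2009, Prop. III.8.1(c)] -/
theorem dualKerChar_eq_zero_iff (Q : ψ.toAddMonoidHom.ker) : dualKerChar φ ψ h T hT hker Q = 0 ↔ Q = 0 := by
  refine ⟨fun h0 ↦ ?_, fun h0 ↦ by rw [h0, map_zero]⟩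
  obtain ⟨S, hS, hSQ⟩ := (mem_ker_dual_iff φ ψ h Q.1).mp Q.2
  have hSz : (p : ℤ) • S = 0 := by rw [natCast_zsmul]; exact AddSubgroup.torsionBy.nsmul_iff.mp hS
  have h1 : weilPairingFun (natCast_level_ne_zero F p) S T = 1 := by
    rw [← coe_muVal_dualKerChar_eq φ ψ h T hT hker Q hSz hSQ, h0, muVal_zero, Units.val_one]
  have hmem := mem_zmultiples_of_weilPairingFun_eq_one hT hT0 hSz h1
  rw [← hker, AddMonoidHom.mem_ker, coe_toAddMonoidHom] at hmem
  exact Subtype.ext (hSQ.symm.trans hmem)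

include hT0 in
/-- `χ` is injective. [cite: SilvermanAEC2009, Prop. III.8.1(c)] -/
theorem dualKerChar_injective : Function.Injective (dualKerChar φ ψ h T hT hker) :=
  (injective_iff_map_eq_zero _).mpr fun Q hQ ↦ (dualKerChar_eq_zero_iff φ ψ h T hT hT0 hker Q).mp hQ

include hT0 in
/-- **`χ` is onto `μ_p`** (`e_p(·, T)` maps `E[p]` onto `μ_p`, tree `exists_weilPairingFun_eq`). [cite: SilvermanAEC2009, Prop. III.8.1] -/
theorem dualKerChar_surjective : Function.Surjective (dualKerChar φ ψ h T hT hker) := by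
  intro v
  have hv : ((muVal F p v : (AlgebraicClosure F)ˣ) : AlgebraicClosure F) ^ p = 1 := by
    rw [← Units.val_pow_eq_pow_val, muVal_pow_eq_one, Units.val_one]
  obtain ⟨S, hS, hSv⟩ := exists_weilPairingFun_eq hT hT0 hv
  have hQ : φ S ∈ ψ.toAddMonoidHom.ker :=
    (mem_ker_dual_iff φ ψ h _).mpr ⟨S, by rw [AddSubgroup.torsionBy.nsmul_iff, ← natCast_zsmul]; exact hS, rfl⟩
  refine ⟨⟨φ S, hQ⟩, muVal_injective F p (Units.ext ?_)⟩
  rw [coe_muVal_dualKerChar_eq φ ψ h T hT hker ⟨φ S, hQ⟩ hS rfl, hSv]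

include hTfix in
/-- **`χ` is `Γ_F`-equivariant**: `χ(σQ) = σ χ(Q)` (Galois equivariance of the Weil pairing and `σT = T`).
[cite: SilvermanAEC2009, Prop. III.8.1(d)] -/
theorem dualKerChar_smul (σ : absoluteGaloisGroup F) (Q : ψ.toAddMonoidHom.ker) :
    letI := ψ.kerAction
    dualKerChar φ ψ h T hT hker (σ • Q) = mu F p σ (dualKerChar φ ψ h T hT hker Q) := by
  letI := ψ.kerAction
  apply muVal_injective F p
  rw [muVal_apply]
  apply Units.ext
  rw [Units.coe_smul]
  obtain ⟨S, hS, hSQ⟩ := (mem_ker_dual_iff φ ψ h Q.1).mp Q.2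
  have hSz : (p : ℤ) • S = 0 := by rw [natCast_zsmul]; exact AddSubgroup.torsionBy.nsmul_iff.mp hS
  have hσS : (p : ℤ) • (σ • S) = 0 := by rw [smul_comm, hSz, smul_zero]
  rw [coe_muVal_dualKerChar_eq φ ψ h T hT hker Q hSz hSQ,
    coe_muVal_dualKerChar_eq φ ψ h T hT hker (σ • Q) hσS (by rw [Isogeny.map_smul, hSQ]; rfl),
    ← weilPairingFun_smul _ σ hSz hT, hTfix]

end Character

/-! ## §2 `H¹(χ) : H¹(F, ker ψ) → H¹(F, μ_p)`, injective -/

section Cohomology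

include h hT hTfix hker

/-- `χ` as a morphism of Mathlib's `TopRep ℤ Γ_F` (source `ker ψ` with its discrete topology and the action
`Isogeny.kerAction`, target the Galois module `μ_p`), in the shape consumed by `ContinuousCohomology.map`
along `id : Γ_F → Γ_F`. [cite: SerreGaloisCohomology1997, I.§2.4] -/
def dualKerCharHom :
    letI := ψ.kerAction
    TopRep.res ((ContinuousMonoidHom.id (absoluteGaloisGroup F)) :
        absoluteGaloisGroup F →* absoluteGaloisGroup F)
        (discreteTopRep (absoluteGaloisGroup F) ψ.toAddMonoidHom.ker) ⟶ (mu F p).toTopRep :=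
  letI := ψ.kerAction
  TopRep.ofHom
    { toLinearMap := (dualKerChar φ ψ h T hT hker).toIntLinearMap
      cont := continuous_of_discreteTopology
      isIntertwining' := fun σ ↦ by
        ext Q
        exact dualKerChar_smul φ ψ h T hT hTfix hker σ Q }

/-- Values of `dualKerCharHom`. [cite: SerreGaloisCohomology1997, I.§2.4] -/
@[simp]
theorem dualKerCharHom_hom_apply (Q : ψ.toAddMonoidHom.ker) :
    (dualKerCharHom φ ψ h T hT hTfix hker).hom Q = dualKerChar φ ψ h T hT hker Q :=
  rfl

/-- **`H¹(χ) : H¹(F, ker ψ) →+ H¹(F, μ_p)`** (Mathlib's `ContinuousCohomology.map` along the identity of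
`Γ_F`). [cite: SilvermanAEC2009, Thm. X.4.2 and Prop. X.4.9] -/
def dualKerCharH1 : ψ.galH1Ker →+ H1Mu F p :=
  letI := ψ.kerAction
  (ContinuousCohomology.map (ContinuousMonoidHom.id (absoluteGaloisGroup F))
    (dualKerCharHom φ ψ h T hT hTfix hker) 1).hom.toLinearMap.toAddMonoidHom

/-- **`H¹(χ)` on explicit cocycles**: `[c] ↦ [χ ∘ c]`. [cite: SerreGaloisCohomology1997, I.§2.4] -/
theorem dualKerCharH1_oneCocycleClass
    (c : letI := ψ.kerAction
      contOneCocycles (discreteTopRep (absoluteGaloisGroup F) ψ.toAddMonoidHom.ker)) :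
    letI := ψ.kerAction
    dualKerCharH1 φ ψ h T hT hTfix hker (oneCocycleClass _ c) =
      oneCocycleClass _ (contOneCocycles.pullback (ContinuousMonoidHom.id (absoluteGaloisGroup F))
        (dualKerCharHom φ ψ h T hT hTfix hker) c) := by
  letI := ψ.kerAction
  unfold dualKerCharH1
  simp only [LinearMap.toAddMonoidHom_coe, ContinuousLinearMap.coe_coe]
  exact map_oneCocycleClass _ (ContinuousMonoidHom.id (absoluteGaloisGroup F))
    (dualKerCharHom φ ψ h T hT hTfix hker) c

include hT0 in
/-- **`H¹(χ)` is injective**: if `χ ∘ c` is a coboundary `σ ↦ σv − v` in `μ_p`, write `v = χ(Q₁)` (`χ` is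
onto); then `χ(c(σ) − (σQ₁ − Q₁)) = 0`, so `c` is the coboundary of `Q₁` (`χ` injective and equivariant).
[cite: SilvermanAEC2009, Thm. X.4.2 and Prop. X.4.9] -/
theorem dualKerCharH1_injective : Function.Injective (dualKerCharH1 φ ψ h T hT hTfix hker) := by
  letI := ψ.kerAction
  refine (injective_iff_map_eq_zero _).mpr fun x hx ↦ ?_
  obtain ⟨c, rfl⟩ := oneCocycleClass_surjective _ x
  rw [dualKerCharH1_oneCocycleClass, oneCocycleClass_eq_zero_iff] at hx
  obtain ⟨v, hv⟩ := hx
  obtain ⟨Q₁, rfl⟩ := dualKerChar_surjective φ ψ h T hT hT0 hker v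
  rw [oneCocycleClass_eq_zero_iff]
  refine ⟨Q₁, fun σ ↦ ?_⟩
  have hσ := hv σ
  rw [contOneCocycles.pullback_apply, dualKerCharHom_hom_apply] at hσ
  change dualKerChar φ ψ h T hT hker (c.1 σ) = mu F p σ (dualKerChar φ ψ h T hT hker Q₁) -
    dualKerChar φ ψ h T hT hker Q₁ at hσ
  rw [← dualKerChar_smul φ ψ h T hT hTfix hker, ← map_sub] at hσ
  exact dualKerChar_injective φ ψ h T hT hT0 hker hσ

end Cohomology

/-! ## §3 The Kummer invariant `H¹(F, ker ψ) ↪ Fˣ/Fˣᵖ` and its computation rule -/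

section Kummer

include h hT hTfix hker

/-- **The Kummer invariant** `H¹(F, ker ψ) →+ Fˣ/Fˣᵖ` (additively: `Additive (Fˣ ⧸ (Fˣ)ᵖ)`): `H¹(χ)`
followed by Kummer theory `H¹(F, μ_p) ≃ Fˣ/Fˣᵖ` (tree `kummerEquiv`). On the Kummer image of `E(F)` it is the
descent map `P ↦ f_T(P)` (Silverman Exercise 10.1(c); tree `IsogenyDescentKummerElement`).
[cite: SilvermanAEC2009, Prop. X.4.9 and Exercise 10.1] [cite: Fisher2001FiveSevenDescent, §1] -/
def kummerInvariant : ψ.galH1Ker →+ Additive (Fˣ ⧸ (powMonoidHom p : Fˣ →* Fˣ).range) :=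
  (kummerEquiv F p).toAddMonoidHom.comp (dualKerCharH1 φ ψ h T hT hTfix hker)

include hT0 in
/-- **The Kummer invariant is injective** on `H¹(F, ker ψ)`: in particular `Sel^ψ(E'/F) ↪ Fˣ/Fˣᵖ`.
[cite: SilvermanAEC2009, Prop. X.4.9] -/
theorem kummerInvariant_injective : Function.Injective (kummerInvariant φ ψ h T hT hTfix hker) :=
  (kummerEquiv F p).injective.comp (dualKerCharH1_injective φ ψ h T hT hT0 hTfix hker)

omit [W.IsElliptic] [W'.IsElliptic] [Fact p.Prime] h hT hTfix hker in
/-- **Computation of `kummerEquiv` on a cocycle with a known Kummer generator**: if a continuous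
`μ_p`-cocycle `ξ` satisfies `ξ(σ) = σ(α)/α` in `F̄` for a unit `α` with `αᵖ = a ∈ Fˣ`, then
`kummerEquiv [ξ] = [a]`. (The cocycle IS the Kummer cocycle of `α`, whose class is the Kummer class of
`a`, tree `kummerClassHom_eq_of_pow_eq`, `kummerEquiv_kummerMap`.) [cite: SerreGaloisCohomology1997, II.§1.2] -/
theorem kummerEquiv_oneCocycleClass_eq_of_root (ξ : contOneCocycles (mu F p).toTopRep)
    {α : (AlgebraicClosure F)ˣ} {a : Fˣ}
    (hαp : α ^ p = Units.map (algebraMap F (AlgebraicClosure F) : F →* AlgebraicClosure F) a)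
    (hξ : ∀ σ : absoluteGaloisGroup F, muVal F p (ξ.1 σ) = σ • α / α) :
    kummerEquiv F p (oneCocycleClass _ ξ) = Additive.ofMul (QuotientGroup.mk a) := by
  have hαK : α ∈ kummerUnits F p := by
    intro σ
    rw [hαp]
    ext
    rw [Units.coe_smul, Units.coe_map, MonoidHom.coe_coe, smul_algebraMap]
  have hξeq : ξ = kummerOneCocycle F p ⟨α, hαK⟩ := by
    apply Subtype.ext
    ext σ
    apply muVal_injective F p
    rw [hξ σ, kummerOneCocycle_apply, muVal_kummerOneCocycleFun]
  have hclass : Multiplicative.ofAdd (oneCocycleClass _ ξ) = kummerMap F p a := by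
    rw [hξeq, ← kummerClassHom_apply, kummerMap_apply]
    exact kummerClassHom_eq_of_pow_eq F p (by rw [kummerUnitsRoot_pow]; exact hαp)
  have : oneCocycleClass _ ξ = (kummerMap F p a).toAdd := by rw [← hclass, toAdd_ofAdd]
  rw [this, kummerEquiv_kummerMap]

/-- **Computation rule for the Kummer invariant**: if `χ(c(σ)) = σ(α)/α` in `F̄` for all `σ ∈ Γ_F`, with
`αᵖ = a ∈ Fˣ`, then the Kummer invariant of `[c]` is the class of `a`.
[cite: SilvermanAEC2009, Exercise 10.1(c)] [cite: SerreGaloisCohomology1997, II.§1.2] -/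
theorem kummerInvariant_oneCocycleClass_eq_of_root
    (c : letI := ψ.kerAction
      contOneCocycles (discreteTopRep (absoluteGaloisGroup F) ψ.toAddMonoidHom.ker))
    {α : (AlgebraicClosure F)ˣ} {a : Fˣ}
    (hαp : α ^ p = Units.map (algebraMap F (AlgebraicClosure F) : F →* AlgebraicClosure F) a)
    (hc : ∀ σ : absoluteGaloisGroup F, muVal F p (dualKerChar φ ψ h T hT hker (c.1 σ)) = σ • α / α) :
    letI := ψ.kerAction
    kummerInvariant φ ψ h T hT hTfix hker (oneCocycleClass _ c) = Additive.ofMul (QuotientGroup.mk a) := by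
  letI := ψ.kerAction
  unfold kummerInvariant
  rw [AddMonoidHom.comp_apply, dualKerCharH1_oneCocycleClass]
  exact kummerEquiv_oneCocycleClass_eq_of_root
    (contOneCocycles.pullback (ContinuousMonoidHom.id (absoluteGaloisGroup F))
      (dualKerCharHom φ ψ h T hT hTfix hker) c) hαp fun σ ↦ by
    rw [contOneCocycles.pullback_apply, dualKerCharHom_hom_apply]; exact hc σ

/-- **Hilbert 90 supplies the Kummer generator**: for every cocycle `c : Γ_F → ker ψ` there is a unit
`α ∈ F̄ˣ` with `χ(c(σ)) = σ(α)/α` for all `σ`, and `αᵖ = a` for some `a ∈ Fˣ` (cocycle-level Hilbert 90,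
tree `absoluteGaloisGroup.exists_eq_smul_div_of_isLocallyConstant_cocycle`; `αᵖ` is `Γ_F`-fixed; `F` perfect).
[cite: SerreGaloisCohomology1997, II.§1.2, Prop. 1] -/
theorem exists_root_of_cocycle [PerfectField F]
    (c : letI := ψ.kerAction
      contOneCocycles (discreteTopRep (absoluteGaloisGroup F) ψ.toAddMonoidHom.ker)) :
    ∃ (α : (AlgebraicClosure F)ˣ) (a : Fˣ),
      α ^ p = Units.map (algebraMap F (AlgebraicClosure F) : F →* AlgebraicClosure F) a ∧
        ∀ σ : absoluteGaloisGroup F, muVal F p (dualKerChar φ ψ h T hT hker (c.1 σ)) = σ • α / α := by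
  letI := ψ.kerAction
  -- the `F̄`-valued cocycle `σ ↦ χ(c σ)`
  let ξ := contOneCocycles.pullback (ContinuousMonoidHom.id (absoluteGaloisGroup F))
      (dualKerCharHom φ ψ h T hT hTfix hker) c
  let f : absoluteGaloisGroup F → AlgebraicClosure F := fun σ ↦ (muVal F p (ξ.1 σ) : AlgebraicClosure F)
  have hfξ : ∀ σ, ξ.1 σ = dualKerChar φ ψ h T hT hker (c.1 σ) := fun σ ↦ rfl
  have hf : IsLocallyConstant f :=
    ((IsLocallyConstant.iff_continuous ξ.1).2 ξ.1.continuous).comp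
      fun v : MuCarrier F p ↦ (muVal F p v : AlgebraicClosure F)
  have h0 : ∀ σ, f σ ≠ 0 := fun σ ↦ Units.ne_zero _
  have hcoc : ∀ σ τ, f (σ * τ) = f σ * σ • f τ := by
    intro σ τ
    have e := congrArg (fun v : MuCarrier F p ↦ (muVal F p v : AlgebraicClosure F)) (ξ.2 σ τ)
    simpa [f] using e
  obtain ⟨β, hβ0, hβ⟩ := absoluteGaloisGroup.exists_eq_smul_div_of_isLocallyConstant_cocycle F hf h0 hcoc
  -- `βᵖ` is `Γ_F`-fixed (`(σβ/β)ᵖ = χ(cσ)ᵖ = 1`), hence in `F`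
  have hfp : ∀ σ, f σ ^ p = 1 := fun σ ↦ by
    change ((muVal F p (ξ.1 σ) : (AlgebraicClosure F)ˣ) : AlgebraicClosure F) ^ p = 1
    rw [← Units.val_pow_eq_pow_val, muVal_pow_eq_one, Units.val_one]
  have hfix : ∀ σ : absoluteGaloisGroup F, σ • β ^ p = β ^ p := by
    intro σ
    have e := hfp σ
    rwa [hβ σ, div_pow, ← smul_pow', div_eq_one_iff_eq (pow_ne_zero _ hβ0)] at e
  obtain ⟨a, ha⟩ : ∃ a : F, algebraMap F (AlgebraicClosure F) a = β ^ p :=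
    (InfiniteGalois.mem_range_algebraMap_iff_fixed (β ^ p)).mpr fun σ ↦ hfix σ
  have ha0 : a ≠ 0 := by
    intro h0; rw [h0, map_zero] at ha; exact pow_ne_zero _ hβ0 ha.symm
  refine ⟨Units.mk0 β hβ0, Units.mk0 a ha0, Units.ext ?_, fun σ ↦ Units.ext ?_⟩
  · rw [Units.val_pow_eq_pow_val, Units.val_mk0, Units.coe_map, MonoidHom.coe_coe, Units.val_mk0, ha]
  · rw [← hfξ, Units.val_div_eq_div_val, Units.coe_smul, Units.val_mk0]
    exact hβ σ

end Kummer

end WeierstrassCurve.Isogeny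

end
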